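import Literature.Analysis.InnerProduct.CourantFischerBounds
import Mathlib.Analysis.Matrix.Spectrum
import Mathlib.LinearAlgebra.Matrix.PosDef
import HarnessLib

/-!
# Eigenvalue bounds behind verified-Cholesky certificates: dominated Gram residuals, deflation
# (rank-`k` shifts) and Rayleigh–Ritz, for Hermitian matrices

Topic `Literature/Analysis/InnerProduct` (uses `CourantFischerBounds`). This file is the
floating-point-free SKELETON of the "verified Cholesky" eigenvalue certificates of S. M. Rump,
*Verification of positive definiteness*, BIT 46 (2006) 433–452, Thm. 2.3 [cite: Rump2006, Thm 2.3]
(componentwise residual bound for a Cholesky factor computed in floating point: if the decomposition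
of a symmetric floating-point matrix `B` runs to completion with computed factor `R̃`, then
`|B − R̃ᵀR̃| ≤ γ_{n+1} |R̃|ᵀ|R̃|` entrywise up to an underflow term — his (2.8)–(2.9), Demmel 1989
(LAPACK WN 14) Lemma 2.1, Higham, *Accuracy and Stability of Numerical Algorithms* (2002) Thm. 10.3).
That rounding-error statement concerns IEEE arithmetic and is NOT formalised here; it enters the
theorems below as the HYPOTHESIS `hdom`. What is proved is everything after it:

* `norm_star_dotProduct_mulVec_le_of_norm_le_gram` — if `‖Δ i j‖ ≤ γ Σ_l ‖R l i‖ ‖R l j‖` for all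
  `i, j` (`Δ` dominated entrywise by `γ |R|ᵀ|R|`, `γ ≥ 0`), then `‖⟨v, Δ v⟩‖ ≤ γ ‖R‖_F² ‖v‖²`
  (Perron–Frobenius domination + row-wise Cauchy–Schwarz, `‖ |R| ‖₂ ≤ ‖R‖_F`);
  `norm_star_dotProduct_mulVec_le_of_norm_le_rowSum_colSum` / `posSemidef_add_of_residual_le_rowSum` —
  the same with an arbitrary dominating real matrix `N` of row/column sums `≤ r` (Schur's test; the shape
  an a-posteriori interval verification of the residual `B − Rᴴ R` produces): `B + r·1 ⪰ 0`;
* `posSemidef_add_of_residual_dominated` — `B` Hermitian and `|B − Rᴴ R| ≤ γ |R|ᵀ|R|` entrywise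
  ⇒ `B + γ ‖R‖_F² · 1 ⪰ 0` (Rump's `λ_min(B) ≥ −‖Δ(B)‖₂`, in the Frobenius form used by certificates);
  `posSemidef_sub_of_shifted_residual_dominated` — the shifted form
  `|H − s·1 − Rᴴ R| ≤ γ |R|ᵀ|R| ⇒ H − (s − γ‖R‖_F²)·1 ⪰ 0`, which is exactly the hypothesis shape of
  the sector theorems `Literature.MathematicalPhysics.QuantumLattice.groundEnergyAt_…_posSemidef`;
* `le_eigenvalues_of_forall_mem` / `eigenvalues_le_of_forall_mem` — the trial-subspace halves of
  Courant–Fischer as INEQUALITIES ON `λ_k` (from the existence forms of `CourantFischerBounds`):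
  a form bound `c ‖x‖² ≤ re ⟪T x, x⟫` on a subspace of dimension `≥ k + 1` gives `c ≤ λ_k`, a bound
  `re ⟪T x, x⟫ ≤ μ ‖x‖²` on a subspace of dimension `≥ n − k` gives `λ_k ≤ μ`
  (antitone enumeration `λ₀ ≥ λ₁ ≥ …`);
* `le_eigenvalues_of_forall_orthogonal` — DEFLATION: if `c ‖x‖² ≤ re ⟪T x, x⟫` for every `x`
  orthogonal to `k` given vectors `v₀, …, v_{k-1}`, then `c ≤ λ_i` for every `i` with `i + k + 1 ≤ n`
  (i.e. `c` bounds the `(k+1)`-th smallest eigenvalue from below: "adding a rank-`k` term raises the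
  `i`-th eigenvalue at most to the `(i+k)`-th", Horn–Johnson Cor. 4.3.9 / Weyl);
* matrix forms for a Hermitian `A : Matrix m m 𝕜` and Mathlib's sorted `hA.eigenvalues₀`
  (`Fin (card m) → ℝ`, antitone): `Matrix.IsHermitian.le_eigenvalues₀_of_deflation_posSemidef`
  (`A − σ·1 + Σ_j c_j · v_j v_jᴴ ⪰ 0` with ANY real `c_j` ⇒ `σ ≤ λ_i` for `i + k + 1 ≤ card m`) and
  `Matrix.IsHermitian.eigenvalues₀_le_of_ritz_posSemidef` (RAYLEIGH–RITZ: trial columns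
  `W : Matrix m ι 𝕜` with `Wᴴ W` positive definite and `μ · WᴴW − Wᴴ A W ⪰ 0` ⇒ `λ_i ≤ μ` for
  `card m ≤ i + card ι`, i.e. the `|ι|`-th smallest eigenvalue is `≤ μ`);
  `Matrix.IsHermitian.le_eigenvalues₀_of_sub_posSemidef` (`A − σ·1 ⪰ 0 ⇒ σ ≤ λ_i` for all `i`) and
  `card_filter_le_eq_of_antitone` (CLUSTER COUNT: `λ_{i₀} ≤ μ < λ_i` for `i < i₀` ⇒ exactly `n − i₀`
  eigenvalues, with multiplicity, are `≤ μ`).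

No definitions, no named facts.

## References

* S. M. Rump, *Verification of positive definiteness*, BIT 46 (2006) 433–452, Thm. 2.3. [Rump2006]
* J. Demmel, *On floating point errors in Cholesky*, LAPACK Working Note 14 (1989), Lemma 2.1.
  [Demmel1989Cholesky]
* N. J. Higham, *Accuracy and Stability of Numerical Algorithms*, 2nd ed., SIAM (2002), Thm. 10.3.
  [Higham2002ASNA]
* R. A. Horn, C. R. Johnson, *Matrix Analysis*, 2nd ed., CUP (2013), Thm. 4.2.6, Cor. 4.3.9,
  Thm. 4.3.21 (Rayleigh–Ritz / Poincaré separation). [HornJohnson2013]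
-/

noncomputable section

open Matrix Finset WithLp Module
open scoped InnerProductSpace ComplexOrder BigOperators

namespace Literature.Analysis.InnerProduct

/-! ### Entrywise-dominated residuals: `|Δ| ≤ γ |R|ᵀ|R|` -/

section Residual

variable {𝕜 : Type*} [RCLike 𝕜] {m k : Type*} [Fintype m] [Fintype k]

/-- `star w ⬝ᵥ w = Σ_l ‖w l‖²` (as an element of `𝕜`). [folklore] -/
theorem star_dotProduct_self_eq_ofReal_sum (w : k → 𝕜) :
    star w ⬝ᵥ w = ((∑ l, ‖w l‖ ^ 2 : ℝ) : 𝕜) := by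
  rw [dotProduct]
  push_cast
  exact Finset.sum_congr rfl fun l _ => by rw [Pi.star_apply, RCLike.star_def, RCLike.conj_mul]

/-- **Domination bound.** If `‖Δ i j‖ ≤ γ Σ_l ‖R l i‖ ‖R l j‖` for all `i, j` (`γ ≥ 0`), then
`‖⟨v, Δ v⟩‖ ≤ γ ‖R‖_F² Σ_i ‖v_i‖²`: `|v̄ᵀΔv| ≤ |v|ᵀ(γ|R|ᵀ|R|)|v| = γ Σ_l (Σ_i |R_li||v_i|)² ≤
γ Σ_l (Σ_i |R_li|²)(Σ_i |v_i|²)`. [cite: Rump2006, proof of Thm 2.3] -/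
theorem norm_star_dotProduct_mulVec_le_of_norm_le_gram (Δ : Matrix m m 𝕜) (R : Matrix k m 𝕜)
    {γ : ℝ} (hγ : 0 ≤ γ) (hdom : ∀ i j, ‖Δ i j‖ ≤ γ * ∑ l, ‖R l i‖ * ‖R l j‖) (v : m → 𝕜) :
    ‖star v ⬝ᵥ (Δ *ᵥ v)‖ ≤ γ * (∑ l, ∑ j, ‖R l j‖ ^ 2) * ∑ i, ‖v i‖ ^ 2 := by
  have h1 : ‖star v ⬝ᵥ (Δ *ᵥ v)‖ ≤ ∑ i, ∑ j, ‖Δ i j‖ * (‖v i‖ * ‖v j‖) := by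
    simp only [dotProduct, mulVec, Pi.star_apply, Finset.mul_sum]
    refine (norm_sum_le _ _).trans (Finset.sum_le_sum fun i _ => ?_)
    refine (norm_sum_le _ _).trans (Finset.sum_le_sum fun j _ => ?_)
    rw [norm_mul, norm_mul, norm_star]
    exact le_of_eq (by ring)
  have h2 : ∑ i, ∑ j, ‖Δ i j‖ * (‖v i‖ * ‖v j‖) ≤
      γ * ∑ i, ∑ j, (∑ l, ‖R l i‖ * ‖R l j‖) * (‖v i‖ * ‖v j‖) := by
    rw [Finset.mul_sum]
    refine Finset.sum_le_sum fun i _ => ?_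
    rw [Finset.mul_sum]
    refine Finset.sum_le_sum fun j _ => ?_
    calc ‖Δ i j‖ * (‖v i‖ * ‖v j‖) ≤ (γ * ∑ l, ‖R l i‖ * ‖R l j‖) * (‖v i‖ * ‖v j‖) :=
          mul_le_mul_of_nonneg_right (hdom i j) (by positivity)
      _ = γ * ((∑ l, ‖R l i‖ * ‖R l j‖) * (‖v i‖ * ‖v j‖)) := mul_assoc _ _ _
  have h3 : ∑ i, ∑ j, (∑ l, ‖R l i‖ * ‖R l j‖) * (‖v i‖ * ‖v j‖) =
      ∑ l, (∑ i, ‖R l i‖ * ‖v i‖) ^ 2 := by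
    calc ∑ i, ∑ j, (∑ l, ‖R l i‖ * ‖R l j‖) * (‖v i‖ * ‖v j‖)
        = ∑ i, ∑ j, ∑ l, (‖R l i‖ * ‖v i‖) * (‖R l j‖ * ‖v j‖) := by
          refine Finset.sum_congr rfl fun i _ => Finset.sum_congr rfl fun j _ => ?_
          rw [Finset.sum_mul]
          exact Finset.sum_congr rfl fun l _ => by ring
      _ = ∑ l, ∑ i, ∑ j, (‖R l i‖ * ‖v i‖) * (‖R l j‖ * ‖v j‖) := by
          have hc : ∀ i, ∑ j, ∑ l, (‖R l i‖ * ‖v i‖) * (‖R l j‖ * ‖v j‖) =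
              ∑ l, ∑ j, (‖R l i‖ * ‖v i‖) * (‖R l j‖ * ‖v j‖) := fun i => Finset.sum_comm
          rw [Finset.sum_congr rfl fun i _ => hc i, Finset.sum_comm]
      _ = ∑ l, (∑ i, ‖R l i‖ * ‖v i‖) ^ 2 := by
          refine Finset.sum_congr rfl fun l _ => ?_
          rw [sq, Finset.sum_mul_sum]
  have h4 : ∑ l, (∑ i, ‖R l i‖ * ‖v i‖) ^ 2 ≤ (∑ l, ∑ j, ‖R l j‖ ^ 2) * ∑ i, ‖v i‖ ^ 2 := by
    rw [Finset.sum_mul]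
    exact Finset.sum_le_sum fun l _ => Finset.sum_mul_sq_le_sq_mul_sq _ _ _
  calc ‖star v ⬝ᵥ (Δ *ᵥ v)‖ ≤ ∑ i, ∑ j, ‖Δ i j‖ * (‖v i‖ * ‖v j‖) := h1
    _ ≤ γ * ∑ i, ∑ j, (∑ l, ‖R l i‖ * ‖R l j‖) * (‖v i‖ * ‖v j‖) := h2
    _ = γ * ∑ l, (∑ i, ‖R l i‖ * ‖v i‖) ^ 2 := by rw [h3]
    _ ≤ γ * ((∑ l, ∑ j, ‖R l j‖ ^ 2) * ∑ i, ‖v i‖ ^ 2) := mul_le_mul_of_nonneg_left h4 hγ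
    _ = γ * (∑ l, ∑ j, ‖R l j‖ ^ 2) * ∑ i, ‖v i‖ ^ 2 := by ring

/-- **Schur's bound with a dominating matrix.** If `‖Δ i j‖ ≤ N i j` entrywise and every row sum and
every column sum of `N` is `≤ r`, then `‖⟨v, Δ v⟩‖ ≤ r Σ_i ‖v_i‖²` (`‖Δ‖₂ ≤ ‖ |Δ| ‖₂ ≤ ‖N‖₂ ≤ √(‖N‖₁‖N‖_∞)`;
the form an A-POSTERIORI interval verification of a residual delivers). Horn–Johnson (2013) §5.6 /
Thm 8.1.22. [folklore] -/
theorem norm_star_dotProduct_mulVec_le_of_norm_le_rowSum_colSum (Δ : Matrix m m 𝕜)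
    (N : Matrix m m ℝ) (hdom : ∀ i j, ‖Δ i j‖ ≤ N i j) {r : ℝ} (hrow : ∀ i, ∑ j, N i j ≤ r)
    (hcol : ∀ j, ∑ i, N i j ≤ r) (v : m → 𝕜) :
    ‖star v ⬝ᵥ (Δ *ᵥ v)‖ ≤ r * ∑ i, ‖v i‖ ^ 2 := by
  have h1 : ‖star v ⬝ᵥ (Δ *ᵥ v)‖ ≤ ∑ i, ∑ j, N i j * (‖v i‖ * ‖v j‖) := by
    simp only [dotProduct, mulVec, Pi.star_apply, Finset.mul_sum]
    refine (norm_sum_le _ _).trans (Finset.sum_le_sum fun i _ => ?_)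
    refine (norm_sum_le _ _).trans (Finset.sum_le_sum fun j _ => ?_)
    rw [norm_mul, norm_mul, norm_star]
    calc ‖v i‖ * (‖Δ i j‖ * ‖v j‖) = ‖Δ i j‖ * (‖v i‖ * ‖v j‖) := by ring
      _ ≤ N i j * (‖v i‖ * ‖v j‖) := mul_le_mul_of_nonneg_right (hdom i j) (by positivity)
  have h2 : ∀ i j, N i j * (‖v i‖ * ‖v j‖) ≤ N i j * (‖v i‖ ^ 2 / 2) + N i j * (‖v j‖ ^ 2 / 2) := by
    intro i j
    rw [← mul_add]
    refine mul_le_mul_of_nonneg_left ?_ ((norm_nonneg _).trans (hdom i j))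
    nlinarith [sq_nonneg (‖v i‖ - ‖v j‖)]
  have h3 : ∑ i, ∑ j, N i j * (‖v i‖ * ‖v j‖) ≤
      ∑ i, ∑ j, (N i j * (‖v i‖ ^ 2 / 2) + N i j * (‖v j‖ ^ 2 / 2)) :=
    Finset.sum_le_sum fun i _ => Finset.sum_le_sum fun j _ => h2 i j
  have h4 : ∑ i, ∑ j, (N i j * (‖v i‖ ^ 2 / 2) + N i j * (‖v j‖ ^ 2 / 2)) =
      ∑ i, (‖v i‖ ^ 2 / 2) * ∑ j, N i j + ∑ j, (‖v j‖ ^ 2 / 2) * ∑ i, N i j := by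
    rw [Finset.sum_congr rfl fun i _ => Finset.sum_add_distrib, Finset.sum_add_distrib]
    congr 1
    · refine Finset.sum_congr rfl fun i _ => ?_
      rw [Finset.mul_sum]
      exact Finset.sum_congr rfl fun j _ => by ring
    · rw [Finset.sum_comm]
      refine Finset.sum_congr rfl fun j _ => ?_
      rw [Finset.mul_sum]
      exact Finset.sum_congr rfl fun i _ => by ring
  have h5 : ∑ i, (‖v i‖ ^ 2 / 2) * ∑ j, N i j ≤ ∑ i, (‖v i‖ ^ 2 / 2) * r :=
    Finset.sum_le_sum fun i _ => mul_le_mul_of_nonneg_left (hrow i) (by positivity)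
  have h6 : ∑ j, (‖v j‖ ^ 2 / 2) * ∑ i, N i j ≤ ∑ j, (‖v j‖ ^ 2 / 2) * r :=
    Finset.sum_le_sum fun j _ => mul_le_mul_of_nonneg_left (hcol j) (by positivity)
  have h7 : ∑ i, (‖v i‖ ^ 2 / 2) * r = (r * ∑ i, ‖v i‖ ^ 2) / 2 := by
    rw [Finset.mul_sum, Finset.sum_div]
    exact Finset.sum_congr rfl fun i _ => by ring
  linarith [h1, h3, h4, h5, h6, h7]

variable [DecidableEq m]

/-- **A-posteriori residual certificate.** If `B` is Hermitian and `‖(B − Rᴴ R) i j‖ ≤ N i j` with a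
real matrix `N` whose row sums and column sums are `≤ r` (e.g. `N` symmetric, as an interval evaluation
of the residual gives), then `B + r·1 ⪰ 0`. [folklore] -/
theorem posSemidef_add_of_residual_le_rowSum {B : Matrix m m 𝕜} (hB : B.IsHermitian)
    (R : Matrix k m 𝕜) (N : Matrix m m ℝ) (hdom : ∀ i j, ‖(B - Rᴴ * R) i j‖ ≤ N i j) {r : ℝ}
    (hrow : ∀ i, ∑ j, N i j ≤ r) (hcol : ∀ j, ∑ i, N i j ≤ r) :
    (B + (r : 𝕜) • (1 : Matrix m m 𝕜)).PosSemidef := by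
  have hherm : (B + (r : 𝕜) • (1 : Matrix m m 𝕜)).IsHermitian := by
    refine hB.add ?_
    rw [IsHermitian, conjTranspose_smul, conjTranspose_one, RCLike.star_def, RCLike.conj_ofReal]
  refine PosSemidef.of_dotProduct_mulVec_nonneg hherm fun v => ?_
  have him := hherm.im_star_dotProduct_mulVec_self v
  rw [RCLike.nonneg_iff]
  refine ⟨?_, him⟩
  have hsplit : star v ⬝ᵥ ((B + (r : 𝕜) • (1 : Matrix m m 𝕜)) *ᵥ v) =
      star (R *ᵥ v) ⬝ᵥ (R *ᵥ v) + star v ⬝ᵥ ((B - Rᴴ * R) *ᵥ v) + (r : 𝕜) * (star v ⬝ᵥ v) := by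
    have hBv : B *ᵥ v = (Rᴴ * R) *ᵥ v + (B - Rᴴ * R) *ᵥ v := by
      rw [← add_mulVec, add_sub_cancel]
    rw [add_mulVec, smul_mulVec, one_mulVec, dotProduct_add, dotProduct_smul, smul_eq_mul, hBv,
      dotProduct_add, ← mulVec_mulVec, dotProduct_mulVec, ← star_mulVec]
  have hΔ := norm_star_dotProduct_mulVec_le_of_norm_le_rowSum_colSum (B - Rᴴ * R) N hdom hrow hcol v
  have hre : -(r * ∑ i, ‖v i‖ ^ 2) ≤ RCLike.re (star v ⬝ᵥ ((B - Rᴴ * R) *ᵥ v)) :=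
    (abs_le.1 ((RCLike.abs_re_le_norm _).trans hΔ)).1
  rw [hsplit, map_add, map_add, star_dotProduct_self_eq_ofReal_sum, star_dotProduct_self_eq_ofReal_sum,
    RCLike.ofReal_re, ← RCLike.ofReal_mul, RCLike.ofReal_re]
  have hsq : (0 : ℝ) ≤ ∑ l, ‖(R *ᵥ v) l‖ ^ 2 := Finset.sum_nonneg fun l _ => by positivity
  linarith

/-- **Rump's bound in certificate form.** If `B` is Hermitian and the residual `B − Rᴴ R` of some
(e.g. floating-point Cholesky) factor `R` is dominated entrywise, `‖(B − Rᴴ R) i j‖ ≤ γ Σ_l ‖R l i‖ ‖R l j‖`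
(`γ ≥ 0`), then `B + γ ‖R‖_F² · 1 ⪰ 0`, i.e. `λ_min(B) ≥ −γ ‖R‖_F²`. [cite: Rump2006, Thm 2.3] -/
theorem posSemidef_add_of_residual_dominated {B : Matrix m m 𝕜} (hB : B.IsHermitian)
    (R : Matrix k m 𝕜) {γ : ℝ} (hγ : 0 ≤ γ)
    (hdom : ∀ i j, ‖(B - Rᴴ * R) i j‖ ≤ γ * ∑ l, ‖R l i‖ * ‖R l j‖) :
    (B + ((γ * ∑ l, ∑ j, ‖R l j‖ ^ 2 : ℝ) : 𝕜) • (1 : Matrix m m 𝕜)).PosSemidef := by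
  set ρ : ℝ := γ * ∑ l, ∑ j, ‖R l j‖ ^ 2 with hρ
  have hherm : (B + (ρ : 𝕜) • (1 : Matrix m m 𝕜)).IsHermitian := by
    refine hB.add ?_
    rw [IsHermitian, conjTranspose_smul, conjTranspose_one, RCLike.star_def, RCLike.conj_ofReal]
  refine PosSemidef.of_dotProduct_mulVec_nonneg hherm fun v => ?_
  have him := hherm.im_star_dotProduct_mulVec_self v
  rw [RCLike.nonneg_iff]
  refine ⟨?_, him⟩
  have hsplit : star v ⬝ᵥ ((B + (ρ : 𝕜) • (1 : Matrix m m 𝕜)) *ᵥ v) =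
      star (R *ᵥ v) ⬝ᵥ (R *ᵥ v) + star v ⬝ᵥ ((B - Rᴴ * R) *ᵥ v) + (ρ : 𝕜) * (star v ⬝ᵥ v) := by
    have hBv : B *ᵥ v = (Rᴴ * R) *ᵥ v + (B - Rᴴ * R) *ᵥ v := by
      rw [← add_mulVec, add_sub_cancel]
    rw [add_mulVec, smul_mulVec, one_mulVec, dotProduct_add, dotProduct_smul, smul_eq_mul, hBv,
      dotProduct_add, ← mulVec_mulVec, dotProduct_mulVec, ← star_mulVec]
  have hΔ := norm_star_dotProduct_mulVec_le_of_norm_le_gram (B - Rᴴ * R) R hγ hdom v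
  have hre : -(ρ * ∑ i, ‖v i‖ ^ 2) ≤ RCLike.re (star v ⬝ᵥ ((B - Rᴴ * R) *ᵥ v)) := by
    have h := (abs_le.1 ((RCLike.abs_re_le_norm _).trans hΔ)).1
    rw [hρ]
    linarith
  rw [hsplit, map_add, map_add, star_dotProduct_self_eq_ofReal_sum, star_dotProduct_self_eq_ofReal_sum,
    RCLike.ofReal_re, ← RCLike.ofReal_mul, RCLike.ofReal_re]
  have hsq : (0 : ℝ) ≤ ∑ l, ‖(R *ᵥ v) l‖ ^ 2 := Finset.sum_nonneg fun l _ => by positivity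
  linarith

/-- **Shifted form** (the shape produced by a verified Cholesky run on `H − s·1`): if `H` is Hermitian
and `‖(H − s·1 − Rᴴ R) i j‖ ≤ γ Σ_l ‖R l i‖ ‖R l j‖` for all `i, j` (`γ ≥ 0`), then
`H − (s − γ ‖R‖_F²)·1 ⪰ 0`, i.e. every eigenvalue of `H` is `≥ s − γ ‖R‖_F²`.
[cite: Rump2006, Thm 2.3 and Cor 2.4] -/
theorem posSemidef_sub_of_shifted_residual_dominated {H : Matrix m m 𝕜} (hH : H.IsHermitian)
    (R : Matrix k m 𝕜) {s γ : ℝ} (hγ : 0 ≤ γ)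
    (hdom : ∀ i j, ‖(H - (s : 𝕜) • (1 : Matrix m m 𝕜) - Rᴴ * R) i j‖ ≤ γ * ∑ l, ‖R l i‖ * ‖R l j‖) :
    (H - ((s - γ * ∑ l, ∑ j, ‖R l j‖ ^ 2 : ℝ) : 𝕜) • (1 : Matrix m m 𝕜)).PosSemidef := by
  have hB : (H - (s : 𝕜) • (1 : Matrix m m 𝕜)).IsHermitian := by
    refine hH.sub ?_
    rw [IsHermitian, conjTranspose_smul, conjTranspose_one, RCLike.star_def, RCLike.conj_ofReal]
  have h := posSemidef_add_of_residual_dominated hB R hγ hdom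
  have heq : H - ((s - γ * ∑ l, ∑ j, ‖R l j‖ ^ 2 : ℝ) : 𝕜) • (1 : Matrix m m 𝕜) =
      H - (s : 𝕜) • (1 : Matrix m m 𝕜) + ((γ * ∑ l, ∑ j, ‖R l j‖ ^ 2 : ℝ) : 𝕜) • (1 : Matrix m m 𝕜) := by
    rw [RCLike.ofReal_sub, sub_smul]
    abel
  rw [heq]
  exact h

end Residual

/-! ### Courant–Fischer as inequalities on `λ_k`; deflation -/

section CourantFischer

variable {𝕜 : Type*} [RCLike 𝕜] {E : Type*} [NormedAddCommGroup E] [InnerProductSpace 𝕜 E]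
  [FiniteDimensional 𝕜 E] {T : E →ₗ[𝕜] E} {n : ℕ}

/-- **Lower bound on `λ_k` from a form bound on a large subspace** (max–min half of Courant–Fischer):
if `c ‖x‖² ≤ re ⟪T x, x⟫` for all `x` in a subspace `W` with `dim W ≥ k + 1`, then `c ≤ λ_k`
(antitone enumeration). [cite: HornJohnson2013, Thm 4.2.6] -/
theorem le_eigenvalues_of_forall_mem (hT : T.IsSymmetric) (hn : finrank 𝕜 E = n) (k : Fin n)
    (W : Submodule 𝕜 E) (hW : (k : ℕ) + 1 ≤ finrank 𝕜 W) {c : ℝ}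
    (hc : ∀ x ∈ W, c * ‖x‖ ^ 2 ≤ RCLike.re ⟪T x, x⟫_𝕜) : c ≤ hT.eigenvalues hn k := by
  obtain ⟨x, hxW, hx0, hle⟩ := exists_mem_re_inner_le_eigenvalues_mul hT hn k W hW
  have hx2 : 0 < ‖x‖ ^ 2 := by positivity
  exact le_of_mul_le_mul_right ((hc x hxW).trans hle) hx2

/-- **Upper bound on `λ_k` from a form bound on a large subspace** (min–max half of Courant–Fischer):
if `re ⟪T x, x⟫ ≤ μ ‖x‖²` for all `x` in a subspace `W` with `dim W ≥ n − k`, then `λ_k ≤ μ`.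
[cite: HornJohnson2013, Thm 4.2.6] -/
theorem eigenvalues_le_of_forall_mem (hT : T.IsSymmetric) (hn : finrank 𝕜 E = n) (k : Fin n)
    (W : Submodule 𝕜 E) (hW : n ≤ finrank 𝕜 W + k) {μ : ℝ}
    (hμ : ∀ x ∈ W, RCLike.re ⟪T x, x⟫_𝕜 ≤ μ * ‖x‖ ^ 2) : hT.eigenvalues hn k ≤ μ := by
  obtain ⟨x, hxW, hx0, hle⟩ := exists_mem_eigenvalues_mul_le_re_inner hT hn k W hW
  have hx2 : 0 < ‖x‖ ^ 2 := by positivity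
  exact le_of_mul_le_mul_right (hle.trans (hμ x hxW)) hx2

/-- **Deflation.** If `c ‖x‖² ≤ re ⟪T x, x⟫` for every `x` orthogonal to `k` given vectors
`v₀, …, v_{k-1}` (e.g. because `T + Σ_j c_j |v_j⟩⟨v_j| − c ⪰ 0` for SOME real `c_j`), then `c ≤ λ_i` for
every index `i` with `i + k + 1 ≤ n` — in ascending order: `c` is a lower bound for the `(k+1)`-th
smallest eigenvalue and all larger ones (the orthogonal complement of `span {v_j}` has dimension
`≥ n − k ≥ i + 1`). This is the eigenvalue half of "a rank-`k` perturbation moves the `i`-th eigenvalue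
at most to the `(i+k)`-th". [cite: HornJohnson2013, Cor 4.3.9] -/
theorem le_eigenvalues_of_forall_orthogonal (hT : T.IsSymmetric) (hn : finrank 𝕜 E = n) {k : ℕ}
    (v : Fin k → E) {c : ℝ}
    (hc : ∀ x : E, (∀ j, ⟪v j, x⟫_𝕜 = 0) → c * ‖x‖ ^ 2 ≤ RCLike.re ⟪T x, x⟫_𝕜)
    (i : Fin n) (hi : (i : ℕ) + k + 1 ≤ n) : c ≤ hT.eigenvalues hn i := by
  classical
  set V : Submodule 𝕜 E := Submodule.span 𝕜 (Set.range v) with hV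
  have hVk : finrank 𝕜 V ≤ k := by
    have h := finrank_range_le_card (R := 𝕜) v
    simpa [Set.finrank, hV] using h
  have hW : (i : ℕ) + 1 ≤ finrank 𝕜 Vᗮ := by
    have h := V.finrank_add_finrank_orthogonal
    rw [hn] at h
    omega
  refine le_eigenvalues_of_forall_mem hT hn i Vᗮ hW fun x hx => hc x fun j => ?_
  exact (Submodule.mem_orthogonal V x).1 hx (v j) (Submodule.subset_span ⟨j, rfl⟩)

end CourantFischer

/-! ### Matrix forms: Mathlib's sorted `Matrix.IsHermitian.eigenvalues₀` -/

section MatrixForms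

variable {𝕜 : Type*} [RCLike 𝕜] {m ι : Type*} [Fintype m] [DecidableEq m] [Fintype ι]

/-- `⟪x, A x⟫ = star x ⬝ᵥ (A *ᵥ x)` on `EuclideanSpace 𝕜 m` (bridge between the inner-product and the
matrix quadratic form). [folklore] -/
theorem inner_self_toEuclideanLin (A : Matrix m m 𝕜) (x : EuclideanSpace 𝕜 m) :
    ⟪x, toEuclideanLin A x⟫_𝕜 = star (ofLp x) ⬝ᵥ (A *ᵥ ofLp x) := by
  rw [EuclideanSpace.inner_eq_star_dotProduct, dotProduct_comm]
  rfl

omit [DecidableEq m] in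
/-- `star x ⬝ᵥ x = ‖x‖²` (in `𝕜`) for `x : EuclideanSpace 𝕜 m`. [folklore] -/
theorem star_dotProduct_self_euclidean (x : EuclideanSpace 𝕜 m) :
    star (ofLp x) ⬝ᵥ ofLp x = ((‖x‖ ^ 2 : ℝ) : 𝕜) := by
  rw [dotProduct_comm, ← EuclideanSpace.inner_eq_star_dotProduct, inner_self_eq_norm_sq_to_K]
  norm_cast

omit [DecidableEq m] in
/-- `star y ⬝ᵥ ((a bᵀ) y) = (star y ⬝ᵥ a) (b ⬝ᵥ y)` for the rank-one matrix `vecMulVec a b`.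
[folklore] -/
theorem star_dotProduct_vecMulVec_mulVec (y a b : m → 𝕜) :
    star y ⬝ᵥ (vecMulVec a b *ᵥ y) = (star y ⬝ᵥ a) * (b ⬝ᵥ y) := by
  simp only [dotProduct, mulVec, vecMulVec_apply, Pi.star_apply]
  rw [Finset.sum_mul_sum]
  refine Finset.sum_congr rfl fun i _ => ?_
  rw [Finset.mul_sum]
  exact Finset.sum_congr rfl fun l _ => by ring

/-- **Deflation certificate (matrix form).** Let `A` be Hermitian with sorted eigenvalues
`λ₀ ≥ λ₁ ≥ … ≥ λ_{|m|-1}` (`hA.eigenvalues₀`). If for some real `σ`, vectors `v₀, …, v_{k-1}` and ANY real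
coefficients `c_j` the matrix `A − σ·1 + Σ_j c_j · v_j v_jᴴ` is positive semidefinite, then
`σ ≤ λ_i` for every `i` with `i + k + 1 ≤ |m|`; in particular `σ` is a lower bound for the
`(k+1)`-th smallest eigenvalue of `A` (take `i = |m| − k − 1`). With `k = 0` this is
`A − σ·1 ⪰ 0 ⇒ σ ≤ λ_min`. The positive semidefiniteness is what a verified Cholesky run on the
(exactly assembled) shifted, deflated matrix delivers via `posSemidef_sub_of_shifted_residual_dominated`.
[cite: Rump2006, Thm 2.3] [cite: HornJohnson2013, Cor 4.3.9] -/
theorem _root_.Matrix.IsHermitian.le_eigenvalues₀_of_deflation_posSemidef {A : Matrix m m 𝕜}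
    (hA : A.IsHermitian) {k : ℕ} (v : Fin k → m → 𝕜) (c : Fin k → ℝ) {σ : ℝ}
    (hpsd : (A - (σ : 𝕜) • (1 : Matrix m m 𝕜) +
      ∑ j, ((c j : ℝ) : 𝕜) • vecMulVec (v j) (star (v j))).PosSemidef)
    (i : Fin (Fintype.card m)) (hi : (i : ℕ) + k + 1 ≤ Fintype.card m) :
    σ ≤ hA.eigenvalues₀ i := by
  have hT : (toEuclideanLin A).IsSymmetric := isSymmetric_toEuclideanLin_iff.mpr hA
  change σ ≤ hT.eigenvalues finrank_euclideanSpace i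
  refine le_eigenvalues_of_forall_orthogonal hT finrank_euclideanSpace (fun j => toLp 2 (v j)) ?_ i hi
  intro x hx
  have hx' : ∀ j, star (v j) ⬝ᵥ ofLp x = 0 := fun j => by
    have h := hx j
    rw [EuclideanSpace.inner_eq_star_dotProduct, dotProduct_comm] at h
    exact h
  have h0 := hpsd.dotProduct_mulVec_nonneg (ofLp x)
  rw [add_mulVec, sub_mulVec, smul_mulVec, one_mulVec, Matrix.sum_mulVec, dotProduct_add,
    dotProduct_sub, dotProduct_smul, dotProduct_sum] at h0
  have hvan : ∑ j, star (ofLp x) ⬝ᵥ ((((c j : ℝ) : 𝕜) • vecMulVec (v j) (star (v j))) *ᵥ ofLp x) = 0 := by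
    refine Finset.sum_eq_zero fun j _ => ?_
    rw [smul_mulVec, dotProduct_smul, star_dotProduct_vecMulVec_mulVec, hx' j, mul_zero, smul_zero]
  rw [hvan, add_zero, smul_eq_mul, star_dotProduct_self_euclidean, RCLike.nonneg_iff, map_sub,
    ← RCLike.ofReal_mul, RCLike.ofReal_re] at h0
  rw [hT x x, inner_self_toEuclideanLin]
  linarith [h0.1]

/-- **Rayleigh–Ritz certificate (matrix form).** Let `A` be Hermitian, `W : Matrix m ι 𝕜` a family of
`|ι|` trial columns with positive definite Gram matrix `Wᴴ W` (linear independence), and `μ` real with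
`μ · Wᴴ W − Wᴴ A W ⪰ 0` (all Ritz values of `A` on `span W` are `≤ μ`). Then `λ_i ≤ μ` for every `i`
with `|m| ≤ i + |ι|` — in ascending order: the `|ι|`-th smallest eigenvalue of `A` (index
`i = |m| − |ι|`) and all smaller ones are `≤ μ` (Poincaré separation / Courant–Fischer on `span W`,
`dim = |ι|`). [cite: HornJohnson2013, Thm 4.3.21] -/
theorem _root_.Matrix.IsHermitian.eigenvalues₀_le_of_ritz_posSemidef {A : Matrix m m 𝕜}
    (hA : A.IsHermitian) (W : Matrix m ι 𝕜) (hG : (Wᴴ * W).PosDef) {μ : ℝ}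
    (hpsd : ((μ : 𝕜) • (Wᴴ * W) - Wᴴ * A * W).PosSemidef)
    (i : Fin (Fintype.card m)) (hi : Fintype.card m ≤ (i : ℕ) + Fintype.card ι) :
    hA.eigenvalues₀ i ≤ μ := by
  have hT : (toEuclideanLin A).IsSymmetric := isSymmetric_toEuclideanLin_iff.mpr hA
  change hT.eigenvalues finrank_euclideanSpace i ≤ μ
  -- the trial map `a ↦ W a` into `EuclideanSpace 𝕜 m`
  let f : (ι → 𝕜) →ₗ[𝕜] EuclideanSpace 𝕜 m :=
    (WithLp.linearEquiv 2 𝕜 (m → 𝕜)).symm.toLinearMap ∘ₗ Matrix.mulVecLin W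
  have hf : ∀ a, f a = toLp 2 (W *ᵥ a) := fun a => rfl
  have hinj : Function.Injective f := by
    rw [← LinearMap.ker_eq_bot, Submodule.eq_bot_iff]
    intro a ha
    rw [LinearMap.mem_ker, hf] at ha
    have hWa : W *ᵥ a = 0 := by simpa using congrArg ofLp ha
    by_contra h0
    have hpos := hG.dotProduct_mulVec_pos h0
    rw [← mulVec_mulVec, hWa, mulVec_zero, dotProduct_zero] at hpos
    exact lt_irrefl _ hpos
  have hdim : finrank 𝕜 (LinearMap.range f) = Fintype.card ι := by
    rw [LinearMap.finrank_range_of_inj hinj, finrank_fintype_fun_eq_card]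
  refine eigenvalues_le_of_forall_mem hT finrank_euclideanSpace i (LinearMap.range f)
    (by rw [hdim]; omega) fun x hx => ?_
  obtain ⟨a, rfl⟩ := LinearMap.mem_range.1 hx
  have h0 := hpsd.dotProduct_mulVec_nonneg a
  rw [sub_mulVec, smul_mulVec, dotProduct_sub, dotProduct_smul, smul_eq_mul, ← mulVec_mulVec,
    ← mulVec_mulVec, ← mulVec_mulVec, dotProduct_mulVec (star a) Wᴴ, ← star_mulVec,
    dotProduct_mulVec (star a) Wᴴ, ← star_mulVec] at h0
  rw [hT (f a) (f a), inner_self_toEuclideanLin, hf]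
  have hnorm : star (W *ᵥ a) ⬝ᵥ (W *ᵥ a) = ((‖toLp 2 (W *ᵥ a)‖ ^ 2 : ℝ) : 𝕜) :=
    star_dotProduct_self_euclidean (toLp 2 (W *ᵥ a))
  change RCLike.re (star (W *ᵥ a) ⬝ᵥ (A *ᵥ (W *ᵥ a))) ≤ μ * ‖toLp 2 (W *ᵥ a)‖ ^ 2
  rw [hnorm, RCLike.nonneg_iff, map_sub, ← RCLike.ofReal_mul, RCLike.ofReal_re] at h0
  linarith [h0.1]

/-- **All eigenvalues from one PSD certificate** (`k = 0` of the deflation form): `A − σ·1 ⪰ 0 ⇒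
σ ≤ λ_i` for every `i`. [folklore] -/
theorem _root_.Matrix.IsHermitian.le_eigenvalues₀_of_sub_posSemidef {A : Matrix m m 𝕜}
    (hA : A.IsHermitian) {σ : ℝ} (hpsd : (A - (σ : 𝕜) • (1 : Matrix m m 𝕜)).PosSemidef)
    (i : Fin (Fintype.card m)) : σ ≤ hA.eigenvalues₀ i := by
  refine hA.le_eigenvalues₀_of_deflation_posSemidef (k := 0) (fun j => Fin.elim0 j)
    (fun j => Fin.elim0 j) ?_ i (by omega)
  simpa using hpsd

/-- **Cluster count.** For an antitone enumeration `λ : Fin n → ℝ` (e.g. `hA.eigenvalues₀`), if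
`λ i₀ ≤ μ` and `μ < λ i` for all `i < i₀`, then exactly `n − i₀` indices carry an eigenvalue `≤ μ`
(namely `i₀, …, n − 1`): the window `(−∞, μ]` contains exactly `n − i₀` eigenvalues counted with
multiplicity. Combine a Rayleigh–Ritz upper bound at `i₀` with a deflation lower bound `> μ` at
`i₀ − 1`. [folklore] -/
theorem card_filter_le_eq_of_antitone {n : ℕ} {f : Fin n → ℝ} (hf : Antitone f) {μ : ℝ}
    (i₀ : Fin n) (hle : f i₀ ≤ μ) (hlt : ∀ i, i < i₀ → μ < f i) :
    (Finset.univ.filter fun i => f i ≤ μ).card = n - i₀ := by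
  have hset : (Finset.univ.filter fun i => f i ≤ μ) = Finset.Ici i₀ := by
    ext i
    simp only [Finset.mem_filter, Finset.mem_univ, true_and, Finset.mem_Ici]
    constructor
    · intro h
      by_contra hi
      exact absurd h (not_le.2 (hlt i (not_le.1 hi)))
    · intro hi
      exact (hf hi).trans hle
  rw [hset, Fin.card_Ici]

end MatrixForms

end Literature.Analysis.InnerProduct

end
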